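import Mathlib

/-!
# A-priori bound for a 2 × 2 block system via the Schur complement (solo-blind s80, §24.90 J-tail plan)

Head ⊕ tail splitting `X = E ⊕ F` of the cross-leaf chain: the monodromy of the infinite system is
`[[A, B], [C, D]]` with a certified head resolvent (`‖u‖ ≤ K ‖u - A u‖`), a dissipative tail
(`‖v‖ ≤ K' ‖v - D v‖`, `K'` close to `1`) and couplings `‖B v‖ ≤ b ‖v‖`, `‖C u‖ ≤ c ‖u‖` whose
product `K b K' c` is small (the tail is fed only through the top head mode).  This file records the
a-priori estimate for solutions of `(1 - [[A,B],[C,D]]) (x, y) = (f, g)` that the Schur complement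
gives; with compactness of the tail (Fredholm alternative, paper-level) it is the resolvent bound of
the infinite system from the certified finite one.  Stated pointwise, so it applies to any linear
realisation.

* `schur_apriori_fst`, `schur_apriori_snd` — the bounds on `‖x‖` and `‖y‖`.
-/

namespace Summit.AnomalousDissipation.AnomalousDissipation.Theorems

variable {E F : Type*} [SeminormedAddCommGroup E] [SeminormedAddCommGroup F]

/-- **Schur a-priori bound, head component.**  If `x - Ax - By = f`, `y - Cx - Dy = g`,
`‖x‖ ≤ K ‖x - Ax‖`, `‖y‖ ≤ K' ‖y - Dy‖`, `‖By‖ ≤ b ‖y‖`, `‖Cx‖ ≤ c ‖x‖` with `K, K', b ≥ 0` and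
`K b K' c < 1`, then `‖x‖ ≤ (K ‖f‖ + K b K' ‖g‖) / (1 - K b K' c)`. -/
theorem schur_apriori_fst {K K' b c : ℝ} (hK : 0 ≤ K) (hK' : 0 ≤ K') (hb : 0 ≤ b)
    (hsmall : K * b * K' * c < 1) {x Ax By f : E} {y Cx Dy g : F}
    (hf : x - Ax - By = f) (hg : y - Cx - Dy = g)
    (hA : ‖x‖ ≤ K * ‖x - Ax‖) (hD : ‖y‖ ≤ K' * ‖y - Dy‖)
    (hB : ‖By‖ ≤ b * ‖y‖) (hC : ‖Cx‖ ≤ c * ‖x‖) :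
    ‖x‖ ≤ (K * ‖f‖ + K * b * K' * ‖g‖) / (1 - K * b * K' * c) := by
  have h1 : x - Ax = f + By := by rw [← hf]; abel
  have h2 : y - Dy = g + Cx := by rw [← hg]; abel
  have hx : ‖x‖ ≤ K * (‖f‖ + b * ‖y‖) := by
    calc ‖x‖ ≤ K * ‖x - Ax‖ := hA
      _ = K * ‖f + By‖ := by rw [h1]
      _ ≤ K * (‖f‖ + ‖By‖) := mul_le_mul_of_nonneg_left (norm_add_le _ _) hK
      _ ≤ K * (‖f‖ + b * ‖y‖) := by gcongr
  have hy : ‖y‖ ≤ K' * (‖g‖ + c * ‖x‖) := by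
    calc ‖y‖ ≤ K' * ‖y - Dy‖ := hD
      _ = K' * ‖g + Cx‖ := by rw [h2]
      _ ≤ K' * (‖g‖ + ‖Cx‖) := mul_le_mul_of_nonneg_left (norm_add_le _ _) hK'
      _ ≤ K' * (‖g‖ + c * ‖x‖) := by gcongr
  have hden : 0 < 1 - K * b * K' * c := by linarith
  rw [le_div_iff₀ hden]
  have hKb : 0 ≤ K * b := mul_nonneg hK hb
  have : ‖x‖ ≤ K * ‖f‖ + K * b * (K' * (‖g‖ + c * ‖x‖)) := by
    calc ‖x‖ ≤ K * (‖f‖ + b * ‖y‖) := hx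
      _ = K * ‖f‖ + K * b * ‖y‖ := by ring
      _ ≤ K * ‖f‖ + K * b * (K' * (‖g‖ + c * ‖x‖)) := by gcongr
  nlinarith [this]

/-- **Schur a-priori bound, tail component.**  Under the hypotheses of `schur_apriori_fst` and `0 ≤ c`,
`‖y‖ ≤ K' (‖g‖ + c (K ‖f‖ + K b K' ‖g‖) / (1 - K b K' c))`. -/
theorem schur_apriori_snd {K K' b c : ℝ} (hK : 0 ≤ K) (hK' : 0 ≤ K') (hb : 0 ≤ b) (hc : 0 ≤ c)
    (hsmall : K * b * K' * c < 1) {x Ax By f : E} {y Cx Dy g : F}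
    (hf : x - Ax - By = f) (hg : y - Cx - Dy = g)
    (hA : ‖x‖ ≤ K * ‖x - Ax‖) (hD : ‖y‖ ≤ K' * ‖y - Dy‖)
    (hB : ‖By‖ ≤ b * ‖y‖) (hC : ‖Cx‖ ≤ c * ‖x‖) :
    ‖y‖ ≤ K' * (‖g‖ + c * ((K * ‖f‖ + K * b * K' * ‖g‖) / (1 - K * b * K' * c))) := by
  have hx := schur_apriori_fst hK hK' hb hsmall hf hg hA hD hB hC
  have h2 : y - Dy = g + Cx := by rw [← hg]; abel
  calc ‖y‖ ≤ K' * ‖y - Dy‖ := hD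
    _ = K' * ‖g + Cx‖ := by rw [h2]
    _ ≤ K' * (‖g‖ + ‖Cx‖) := mul_le_mul_of_nonneg_left (norm_add_le _ _) hK'
    _ ≤ K' * (‖g‖ + c * ‖x‖) := by gcongr
    _ ≤ K' * (‖g‖ + c * ((K * ‖f‖ + K * b * K' * ‖g‖) / (1 - K * b * K' * c))) := by gcongr

end Summit.AnomalousDissipation.AnomalousDissipation.Theorems
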